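import Literature.Analysis.FluidPDE.ElgindiEllipticGreenIdentity
import Literature.Analysis.FluidPDE.ElgindiPolarL2Estimate
import Mathlib.Analysis.InnerProductSpace.LaxMilgram
import Mathlib.Analysis.InnerProductSpace.Projection.Basic
import HarnessLib

/-!
# Weak solutions of Elgindi's polar elliptic problem: the energy space and Lax–Milgram
([Elgindi2021] §7.1, "existence and uniqueness follows from the standard `L^p` theory")

Topic `Literature/Analysis/FluidPDE`. Support file (definitions with bodies and proved theorems, no
named facts) on the proof path of the named fact
`Literature.Analysis.FluidPDE.Elgindi.ElgindiGhoulMasmoudi2021_stabilityCore`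
(`ElgindiStabilityDecomposition.lean`). T. M. Elgindi, Ann. of Math. 194 (2021) =
arXiv:1904.04795, §7.1, Proposition 7.1 (p. 19 of the held text): "Then, the unique `L²`
solution to (PolarBSL) with Dirichlet boundary conditions on `[0,∞) × [0,π/2]` satisfies […] We only
establish the a-priori estimate as existence and uniqueness follows from the standard `L^p` theory."

This file supplies the existence in the weak sense. The **test class** `orthClass` (smooth `χ`
compactly supported inside `R > 0` with `χ(R,0) = 0` and `cos θχ ⊥ sin θcos²θ` on every slice; a
submodule), the **graph map** `graphL α : orthClass →ₗ E⁴` (`ElgindiEllipticEnergySpace.lean`), the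
**energy space** `weakSpace α` (closure of its range, a Hilbert space), the **coercivity** of the
energy form on it (`energyForm_coercive_weakSpace`: `min(½, 2α)‖U‖² ≤ B(U,U)`, from the energy
identity `B(Jχ,Jχ) = (L(Ψ),Ψ)` = `integral_strip_ellipticOp_mul_self` and the constrained Poincaré
inequality `12‖Ψ‖² ≤ ‖∂_θΨ‖²`), and the **weak existence and uniqueness** by the Lax–Milgram theorem
(`exists_unique_weakSolution`): for every `F ∈ L²(strip)` there is a unique `U ∈ weakSpace α` with
`B(U, Φ) = ⟨F, Φ₀⟩_{L²}` for all `Φ ∈ weakSpace α`, and `min(½,2α)‖U‖ ≤ ‖F‖`.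
-/

noncomputable section

open MeasureTheory Set Real Filter Function
open _root_.Topology
open scoped ENNReal InnerProductSpace

namespace Literature.Analysis.FluidPDE

namespace Elgindi

/-! ### The test class -/

/-- Additivity of the `K`-moment for continuous slices. [folklore] -/
theorem kMoment_add {f g : ℝ → ℝ → ℝ} (hf : Continuous (uncurry f)) (hg : Continuous (uncurry g)) (z : ℝ) :
    kMoment (fun R θ => f R θ + g R θ) z = kMoment f z + kMoment g z := by
  rw [kMoment_def, kMoment_def, kMoment_def, ← integral_add]
  · exact setIntegral_congr_fun measurableSet_Ioo fun θ _ => by ring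
  · have c : Continuous fun θ => f z θ * kernelK θ := by
      have := hf.comp (Continuous.prodMk_right z); unfold kernelK; fun_prop
    exact (c.continuousOn.integrableOn_Icc (a := 0) (b := π / 2)).mono_set Ioo_subset_Icc_self
  · have c : Continuous fun θ => g z θ * kernelK θ := by
      have := hg.comp (Continuous.prodMk_right z); unfold kernelK; fun_prop
    exact (c.continuousOn.integrableOn_Icc (a := 0) (b := π / 2)).mono_set Ioo_subset_Icc_self

/-- Homogeneity of the `K`-moment. [folklore] -/
theorem kMoment_const_mul (c : ℝ) (f : ℝ → ℝ → ℝ) (z : ℝ) : kMoment (fun R θ => c * f R θ) z = c * kMoment f z := by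
  rw [kMoment_def, kMoment_def, ← MeasureTheory.integral_const_mul]
  exact setIntegral_congr_fun measurableSet_Ioo fun θ _ => by ring

/-- **The test class**: smooth `χ` compactly supported inside `R > 0`, with `χ(R,0) = 0` and
`cos θ·χ(R,·) ⊥ sin θcos²θ` for every `R > 0` (the profiles `Ψ = cos θχ` vanish on `θ = 0, π/2` and are
orthogonal to the adjoint mode, as the solutions are: Step 1 of the proof of Proposition 7.1). [cite: Elgindi2021, §7.1 proof of Proposition 7.1, Step 1 "Ψ is orthogonal to sin(θ)cos²(θ)" (p. 19 of arXiv:1904.04795)] -/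
def orthClass : Submodule ℝ (ℝ → ℝ → ℝ) where
  carrier := {χ | (∀ n : ℕ, ContDiff ℝ n (uncurry χ)) ∧ HasCompactSupport (uncurry χ) ∧
    (∀ p ∈ tsupport (uncurry χ), 0 < p.1) ∧ (∀ R, χ R 0 = 0) ∧
    ∀ R, 0 < R → kMoment (fun R θ => Real.cos θ * χ R θ) R = 0}
  zero_mem' := by
    refine ⟨fun n => ?_, ?_, ?_, fun R => rfl, fun R _ => ?_⟩
    · exact contDiff_const (c := (0:ℝ))
    · exact HasCompactSupport.zero
    · intro p hp
      have h0 : tsupport (uncurry (0 : ℝ → ℝ → ℝ)) = ∅ := tsupport_eq_empty_iff.mpr rfl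
      rw [h0] at hp
      exact absurd hp (Set.notMem_empty _)
    · simp [kMoment_def]
  add_mem' := by
    intro χ₁ χ₂ hχ₁ hχ₂
    obtain ⟨h1, s1, p1, z1, k1⟩ := hχ₁
    obtain ⟨h2, s2, p2, z2, k2⟩ := hχ₂
    have eu : uncurry (χ₁ + χ₂) = fun p => uncurry χ₁ p + uncurry χ₂ p := by funext p; rfl
    refine ⟨fun n => ?_, ?_, fun p hp => ?_, fun R => ?_, fun R hR => ?_⟩
    · rw [eu]; exact (h1 n).add (h2 n)
    · rw [eu]; exact s1.add s2
    · rw [eu] at hp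
      have h := (tsupport_add (uncurry χ₁) (uncurry χ₂)) hp
      rcases h with h | h
      · exact p1 p h
      · exact p2 p h
    · show χ₁ R 0 + χ₂ R 0 = 0
      rw [z1 R, z2 R, add_zero]
    · have c1 : Continuous (uncurry fun R θ => Real.cos θ * χ₁ R θ) := (contDiff_cosProfile (h1 0)).continuous
      have c2 : Continuous (uncurry fun R θ => Real.cos θ * χ₂ R θ) := (contDiff_cosProfile (h2 0)).continuous
      have e : (fun R θ => Real.cos θ * (χ₁ + χ₂) R θ) = fun R θ => Real.cos θ * χ₁ R θ + Real.cos θ * χ₂ R θ := by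
        funext R θ
        show Real.cos θ * (χ₁ R θ + χ₂ R θ) = _
        ring
      rw [e, kMoment_add c1 c2, k1 R hR, k2 R hR, add_zero]
  smul_mem' := by
    intro c χ hχ
    obtain ⟨h1, s1, p1, z1, k1⟩ := hχ
    have eu : uncurry (c • χ) = fun p => c * uncurry χ p := by funext p; rfl
    refine ⟨fun n => ?_, ?_, fun p hp => ?_, fun R => ?_, fun R hR => ?_⟩
    · rw [eu]; exact contDiff_const.mul (h1 n)
    · rw [eu]; exact s1.mul_left
    · rw [eu] at hp; exact p1 p (tsupport_mul_subset_right hp)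
    · show c * χ R 0 = 0
      rw [z1 R, mul_zero]
    · have e : (fun R θ => Real.cos θ * (c • χ) R θ) = fun R θ => c * (Real.cos θ * χ R θ) := by
        funext R θ
        show Real.cos θ * (c * χ R θ) = _
        ring
      rw [e, kMoment_const_mul, k1 R hR, mul_zero]

/-- Membership in the test class, unfolded. [folklore] -/
theorem mem_orthClass {χ : ℝ → ℝ → ℝ} : χ ∈ orthClass ↔ (∀ n : ℕ, ContDiff ℝ n (uncurry χ)) ∧ HasCompactSupport (uncurry χ) ∧
    (∀ p ∈ tsupport (uncurry χ), 0 < p.1) ∧ (∀ R, χ R 0 = 0) ∧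
    ∀ R, 0 < R → kMoment (fun R θ => Real.cos θ * χ R θ) R = 0 := Iff.rfl

/-! ### Linearity of the graph map on the test class -/

/-- `dz` is additive on differentiable functions. [folklore] -/
theorem dz_add_of_contDiff {f g : ℝ → ℝ → ℝ} (hf : ContDiff ℝ 1 (uncurry f)) (hg : ContDiff ℝ 1 (uncurry g)) (R θ : ℝ) :
    dz (fun R θ => f R θ + g R θ) R θ = dz f R θ + dz g R θ := by
  show deriv (fun R' => f R' θ + g R' θ) R = deriv (fun R' => f R' θ) R + deriv (fun R' => g R' θ) R
  have h1 : DifferentiableAt ℝ (fun R' => f R' θ) R := ((hf.comp (contDiff_id.prodMk contDiff_const)).differentiable (by simp)) R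
  have h2 : DifferentiableAt ℝ (fun R' => g R' θ) R := ((hg.comp (contDiff_id.prodMk contDiff_const)).differentiable (by simp)) R
  exact deriv_add h1 h2

/-- `dθ` is additive on differentiable functions. [folklore] -/
theorem dθ_add_of_contDiff {f g : ℝ → ℝ → ℝ} (hf : ContDiff ℝ 1 (uncurry f)) (hg : ContDiff ℝ 1 (uncurry g)) (R θ : ℝ) :
    dθ (fun R θ => f R θ + g R θ) R θ = dθ f R θ + dθ g R θ := by
  show deriv (fun θ' => f R θ' + g R θ') θ = deriv (fun θ' => f R θ') θ + deriv (fun θ' => g R θ') θ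
  have h1 : DifferentiableAt ℝ (fun θ' => f R θ') θ := ((hf.comp (contDiff_const.prodMk contDiff_id)).differentiable (by simp)) θ
  have h2 : DifferentiableAt ℝ (fun θ' => g R θ') θ := ((hg.comp (contDiff_const.prodMk contDiff_id)).differentiable (by simp)) θ
  exact deriv_add h1 h2

/-- `dz (c·f) = c·dz f`. [folklore] -/
theorem dz_const_mul (c : ℝ) (f : ℝ → ℝ → ℝ) (R θ : ℝ) : dz (fun R θ => c * f R θ) R θ = c * dz f R θ := by
  show deriv (fun R' => c * f R' θ) R = c * deriv (fun R' => f R' θ) R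
  exact deriv_const_mul_field c

/-- `dθ (c·f) = c·dθ f`. [folklore] -/
theorem dθ_const_mul' (c : ℝ) (f : ℝ → ℝ → ℝ) (R θ : ℝ) : dθ (fun R θ => c * f R θ) R θ = c * dθ f R θ := by
  show deriv (fun θ' => c * f R θ') θ = c * deriv (fun θ' => f R θ') θ
  exact deriv_const_mul_field c

/-- The graph components are additive in `χ` (for `χ ∈ C¹`). [folklore] -/
theorem graphFn_add {α : ℝ} {χ₁ χ₂ : ℝ → ℝ → ℝ} (h1 : ContDiff ℝ 1 (uncurry χ₁)) (h2 : ContDiff ℝ 1 (uncurry χ₂)) (k : Fin 4) :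
    graphFn α (χ₁ + χ₂) k = graphFn α χ₁ k + graphFn α χ₂ k := by
  have e : (χ₁ + χ₂) = fun R θ => χ₁ R θ + χ₂ R θ := by funext R θ; rfl
  funext p
  fin_cases k <;> simp only [graphFn, Pi.add_apply, e, dz_add_of_contDiff h1 h2, dθ_add_of_contDiff h1 h2] <;> ring

/-- The graph components are homogeneous in `χ`. [folklore] -/
theorem graphFn_smul {α : ℝ} (c : ℝ) (χ : ℝ → ℝ → ℝ) (k : Fin 4) : graphFn α (c • χ) k = c • graphFn α χ k := by
  have e : (c • χ) = fun R θ => c * χ R θ := by funext R θ; rfl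
  funext p
  fin_cases k <;> simp only [graphFn, Pi.smul_apply, smul_eq_mul, e, dz_const_mul, dθ_const_mul'] <;> ring

/-- `toL2` is additive on square-integrable functions. [folklore] -/
theorem toL2_add {f g : ℝ × ℝ → ℝ} (hf : MemLp f 2 stripMeasure) (hg : MemLp g 2 stripMeasure) :
    toL2 (f + g) = toL2 f + toL2 g := by
  rw [toL2_eq_toLp (hf.add hg), toL2_eq_toLp hf, toL2_eq_toLp hg]
  exact MemLp.toLp_add hf hg

/-- `toL2` is homogeneous on square-integrable functions. [folklore] -/
theorem toL2_smul (c : ℝ) {f : ℝ × ℝ → ℝ} (hf : MemLp f 2 stripMeasure) : toL2 (c • f) = c • toL2 f := by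
  rw [toL2_eq_toLp (hf.const_smul c), toL2_eq_toLp hf]
  exact MemLp.toLp_const_smul c hf

/-- **The graph map on the test class is linear**: `graphL α : orthClass →ₗ[ℝ] E⁴`. [folklore] -/
def graphL (α : ℝ) : orthClass →ₗ[ℝ] E4 where
  toFun χ := graphElt α χ
  map_add' χ₁ χ₂ := by
    have h1 : ContDiff ℝ 1 (uncurry (χ₁ : ℝ → ℝ → ℝ)) := χ₁.2.1 1
    have h2 : ContDiff ℝ 1 (uncurry (χ₂ : ℝ → ℝ → ℝ)) := χ₂.2.1 1
    ext k : 1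
    show toL2 (graphFn α ((χ₁ : ℝ → ℝ → ℝ) + χ₂) k) = toL2 (graphFn α χ₁ k) + toL2 (graphFn α χ₂ k)
    rw [graphFn_add h1 h2, toL2_add (memLp_graphFn h1 χ₁.2.2.1 k) (memLp_graphFn h2 χ₂.2.2.1 k)]
  map_smul' c χ := by
    have h1 : ContDiff ℝ 1 (uncurry (χ : ℝ → ℝ → ℝ)) := χ.2.1 1
    ext k : 1
    show toL2 (graphFn α (c • (χ : ℝ → ℝ → ℝ)) k) = c • toL2 (graphFn α χ k)
    rw [graphFn_smul, toL2_smul c (memLp_graphFn h1 χ.2.2.1 k)]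

/-- Unfolding `graphL`. [folklore] -/
theorem graphL_apply (α : ℝ) (χ : orthClass) : graphL α χ = graphElt α χ := rfl

/-! ### The energy space -/

/-- **The energy space** `V = closure of {Jχ : χ ∈ orthClass}` in `E⁴ = L²(strip)⁴`. [cite: Elgindi2021, §7.1 Proposition 7.1 "the unique L² solution … existence and uniqueness follows from the standard L^p theory" (p. 19 of arXiv:1904.04795)] -/
def weakSpace (α : ℝ) : Submodule ℝ E4 := (LinearMap.range (graphL α)).topologicalClosure

/-- The energy space is closed. [folklore] -/
theorem isClosed_weakSpace (α : ℝ) : IsClosed (weakSpace α : Set E4) := (LinearMap.range (graphL α)).isClosed_topologicalClosure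

/-- The energy space is complete (a Hilbert space). [folklore] -/
instance (α : ℝ) : CompleteSpace (weakSpace α) := (isClosed_weakSpace α).completeSpace_coe

/-- Graphs of test functions belong to the energy space. [folklore] -/
theorem graphElt_mem_weakSpace (α : ℝ) {χ : ℝ → ℝ → ℝ} (hχ : χ ∈ orthClass) : graphElt α χ ∈ weakSpace α :=
  Submodule.le_topologicalClosure _ (LinearMap.mem_range.mpr ⟨⟨χ, hχ⟩, rfl⟩)

/-! ### Coercivity on graphs -/

/-- **`12‖Ψ‖² ≤ ‖∂_θΨ‖²`** for `Ψ = cos θχ` in the test class (orthogonality to the adjoint mode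
slice by slice; the constrained Poincaré inequality `orthogonalMode_poincare`).
[cite: Elgindi2021, §7.1 proof of Proposition 7.1, Step 2 (p. 19–20 of arXiv:1904.04795)] -/
theorem integral_strip_sq_le_sq_dθ_of_kMoment {χ : ℝ → ℝ → ℝ} (hχ : ContDiff ℝ 2 (uncurry χ))
    (hs : HasCompactSupport (uncurry χ)) (hχ0 : ∀ R, χ R 0 = 0) {Ψ : ℝ → ℝ → ℝ}
    (hΨ : Ψ = fun R θ => Real.cos θ * χ R θ) (hK : ∀ R, 0 < R → kMoment Ψ R = 0) :
    12 * (∫ p in strip, Ψ p.1 p.2 ^ 2) ≤ ∫ p in strip, dθ Ψ p.1 p.2 ^ 2 := by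
  have hΨ2 : ContDiff ℝ 2 (uncurry Ψ) := by rw [hΨ]; exact contDiff_cosProfile hχ
  have hΨs : HasCompactSupport (uncurry Ψ) := by rw [hΨ]; exact hasCompactSupport_cosProfile hs
  have hdθΨ : ContDiff ℝ 1 (uncurry (dθ Ψ)) := contDiff_dθ_of_contDiff (n := 1) hΨ2
  have hdθΨs : HasCompactSupport (uncurry (dθ Ψ)) := hasCompactSupport_dθ_of hΨs
  have hD0 : ∀ R, Ψ R 0 = 0 := fun R => by rw [hΨ]; simp [hχ0 R]
  have hD1 : ∀ R, Ψ R (π / 2) = 0 := fun R => by rw [hΨ]; simp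
  have cΨ : Continuous fun p : ℝ × ℝ => Ψ p.1 p.2 := hΨ2.continuous
  have cdθ : Continuous fun p : ℝ × ℝ => dθ Ψ p.1 p.2 := hdθΨ.continuous
  have sE : HasCompactSupport fun p : ℝ × ℝ => Ψ p.1 p.2 ^ 2 := by
    have : (fun p : ℝ × ℝ => Ψ p.1 p.2 ^ 2) = fun p : ℝ × ℝ => Ψ p.1 p.2 * Ψ p.1 p.2 := by funext p; ring
    rw [this]; exact hΨs.mul_left
  have sY : HasCompactSupport fun p : ℝ × ℝ => dθ Ψ p.1 p.2 ^ 2 := by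
    have : (fun p : ℝ × ℝ => dθ Ψ p.1 p.2 ^ 2) = fun p : ℝ × ℝ => dθ Ψ p.1 p.2 * dθ Ψ p.1 p.2 := by funext p; ring
    rw [this]; exact hdθΨs.mul_left
  have iE : Integrable fun p : ℝ × ℝ => Ψ p.1 p.2 ^ 2 := (cΨ.pow 2).integrable_of_hasCompactSupport sE
  have iY : Integrable fun p : ℝ × ℝ => dθ Ψ p.1 p.2 ^ 2 := (cdθ.pow 2).integrable_of_hasCompactSupport sY
  have iG : Integrable fun p : ℝ × ℝ => dθ Ψ p.1 p.2 ^ 2 - 12 * Ψ p.1 p.2 ^ 2 := iY.sub (iE.const_mul _)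
  have hslice : ∀ R ∈ Ioi (0 : ℝ), 0 ≤ ∫ θ in Ioo 0 (π / 2), (dθ Ψ R θ ^ 2 - 12 * Ψ R θ ^ 2) := by
    intro R hR
    have huR : ContDiff ℝ 1 fun θ => Ψ R θ := (hΨ2.comp (contDiff_const.prodMk contDiff_id)).of_le (by norm_num)
    have hdu : deriv (fun θ => Ψ R θ) = fun θ => dθ Ψ R θ := rfl
    have horthR : ∫ x in (0 : ℝ)..(π / 2), Ψ R x * (Real.sin x * Real.cos x ^ 2) = 0 := by
      have h := hK R hR
      rw [kMoment_def] at h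
      have e : ∫ θ in Ioo 0 (π / 2), Ψ R θ * kernelK θ = 3 * ∫ θ in Ioo 0 (π / 2), Ψ R θ * (Real.sin θ * Real.cos θ ^ 2) := by
        rw [← MeasureTheory.integral_const_mul]
        refine setIntegral_congr_fun measurableSet_Ioo fun θ _ => ?_
        unfold kernelK; ring
      rw [e] at h
      rw [intervalIntegral.integral_of_le (by positivity), integral_Ioc_eq_integral_Ioo]
      linarith
    have hP := orthogonalMode_poincare huR (hD0 R) (hD1 R) horthR
    rw [hdu] at hP
    rw [intervalIntegral.integral_of_le (by positivity), intervalIntegral.integral_of_le (by positivity),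
      integral_Ioc_eq_integral_Ioo, integral_Ioc_eq_integral_Ioo] at hP
    have cu : Continuous fun θ => Ψ R θ := cΨ.comp (Continuous.prodMk_right R)
    have cdu : Continuous fun θ => dθ Ψ R θ := cdθ.comp (Continuous.prodMk_right R)
    have j1 : IntegrableOn (fun θ => dθ Ψ R θ ^ 2) (Ioo 0 (π / 2)) :=
      ((cdu.pow 2).continuousOn.integrableOn_Icc (a := 0) (b := π / 2)).mono_set Ioo_subset_Icc_self
    have j2 : IntegrableOn (fun θ => 12 * Ψ R θ ^ 2) (Ioo 0 (π / 2)) :=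
      (((cu.pow 2).const_mul _).continuousOn.integrableOn_Icc (a := 0) (b := π / 2)).mono_set Ioo_subset_Icc_self
    rw [integral_sub j1 j2, MeasureTheory.integral_const_mul]
    simp only at hP
    linarith
  have h0 : 0 ≤ ∫ p in strip, (dθ Ψ p.1 p.2 ^ 2 - 12 * Ψ p.1 p.2 ^ 2) := by
    rw [integral_strip_eq_integral_Ioi_integral_Ioo iG]
    exact setIntegral_nonneg measurableSet_Ioi hslice
  have k2 : IntegrableOn (fun p : ℝ × ℝ => 12 * Ψ p.1 p.2 ^ 2) strip := (iE.const_mul _).integrableOn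
  rw [integral_sub iY.integrableOn k2, MeasureTheory.integral_const_mul] at h0
  linarith

/-- The squared norm of a graph element: `‖Jχ‖² = ∫∫Ψ² + ∫∫(αR∂_RΨ)² + ∫∫(∂_θΨ)² + ∫∫(sin θχ)²`. [folklore] -/
theorem norm_graphElt_sq {α : ℝ} {χ : ℝ → ℝ → ℝ} (hχ : ContDiff ℝ 1 (uncurry χ)) (hs : HasCompactSupport (uncurry χ)) :
    ‖graphElt α χ‖ ^ 2 = (∫ p in strip, graphFn α χ 0 p ^ 2) + (∫ p in strip, graphFn α χ 1 p ^ 2) +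
      (∫ p in strip, graphFn α χ 2 p ^ 2) + ∫ p in strip, graphFn α χ 3 p ^ 2 := by
  rw [PiLp.norm_sq_eq_of_L2]
  simp only [Fin.sum_univ_four, graphElt_apply, norm_toL2_sq (memLp_graphFn hχ hs _)]

/-- **Coercivity on graphs of the test class**: `min(½, 2α)‖Jχ‖² ≤ B(Jχ, Jχ)` for `0 < α ≤ 1` (from
the energy identity `B(Jχ,Jχ) = (L(Ψ),Ψ) = α²|RΨ_R|² + ((5α−α²)/2 − 6)|Ψ|² + |Ψ_θ|² + ½|χ|²` and
`12|Ψ|² ≤ |Ψ_θ|²`). [cite: Elgindi2021, §7.1 proof of Proposition 7.1, Step 2 (p. 19 of arXiv:1904.04795)] -/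
theorem energyForm_graphElt_self_ge {α : ℝ} (hα : 0 < α) (hα1 : α ≤ 1) {χ : ℝ → ℝ → ℝ} (hχ : χ ∈ orthClass) :
    min (1 / 2) (2 * α) * ‖graphElt α χ‖ ^ 2 ≤ energyForm α (graphElt α χ) (graphElt α χ) := by
  obtain ⟨hsm, hs, hpos, hχ0, hK⟩ := hχ
  have h2 : ContDiff ℝ 2 (uncurry χ) := hsm 2
  have h1 : ContDiff ℝ 1 (uncurry χ) := hsm 1
  obtain ⟨Ψ, hΨ⟩ : ∃ Ψ : ℝ → ℝ → ℝ, Ψ = fun R θ => Real.cos θ * χ R θ := ⟨_, rfl⟩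
  -- `B(Jχ,Jχ) = ∫ L(Ψ)Ψ`
  have hB : energyForm α (graphElt α χ) (graphElt α χ) = ∫ p in strip, ellipticOp α Ψ p.1 p.2 * Ψ p.1 p.2 := by
    rw [← integral_strip_ellipticOp_mul_eq_energyForm α h2 hs hpos h1 hs hpos hχ0 hΨ]
    refine integral_congr_ae (ae_of_all _ fun p => ?_)
    show ellipticOp α Ψ p.1 p.2 * (Real.cos p.2 * χ p.1 p.2) = _
    rw [hΨ]
  rw [hB, integral_strip_ellipticOp_mul_self α h2 hs hχ0 hΨ, norm_graphElt_sq h1 hs]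
  -- identify the graph integrals
  have g0 : (∫ p in strip, graphFn α χ 0 p ^ 2) = ∫ p in strip, Ψ p.1 p.2 ^ 2 := by
    refine integral_congr_ae (ae_of_all _ fun p => ?_); show (Real.cos p.2 * χ p.1 p.2) ^ 2 = _; simp only [hΨ]
  have g1 : (∫ p in strip, graphFn α χ 1 p ^ 2) = α ^ 2 * ∫ p in strip, (p.1 * dz Ψ p.1 p.2) ^ 2 := by
    rw [← MeasureTheory.integral_const_mul]
    refine integral_congr_ae (ae_of_all _ fun p => ?_)
    show (α * (p.1 * (Real.cos p.2 * dz χ p.1 p.2))) ^ 2 = α ^ 2 * (p.1 * dz Ψ p.1 p.2) ^ 2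
    rw [hΨ, dz_cosProfile h1]; ring
  have g2 : (∫ p in strip, graphFn α χ 2 p ^ 2) = ∫ p in strip, dθ Ψ p.1 p.2 ^ 2 := by
    refine integral_congr_ae (ae_of_all _ fun p => ?_)
    show (-Real.sin p.2 * χ p.1 p.2 + Real.cos p.2 * dθ χ p.1 p.2) ^ 2 = dθ Ψ p.1 p.2 ^ 2
    rw [hΨ, dθ_cosProfile h1]
  have g3 : (∫ p in strip, graphFn α χ 3 p ^ 2) ≤ ∫ p in strip, χ p.1 p.2 ^ 2 := by
    have cχ : Continuous fun p : ℝ × ℝ => χ p.1 p.2 := h1.continuous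
    have i2 : Integrable fun p : ℝ × ℝ => χ p.1 p.2 ^ 2 :=
      (by fun_prop : Continuous fun p : ℝ × ℝ => χ p.1 p.2 ^ 2).integrable_of_hasCompactSupport
        (hasCompactSupport_of_eq_zero (X := fun p : ℝ × ℝ => χ p.1 p.2) hs fun p hp => by simp [hp])
    have i1 : Integrable fun p : ℝ × ℝ => graphFn α χ 3 p ^ 2 :=
      (by have := continuous_graphFn (α := α) h1 3; fun_prop : Continuous fun p : ℝ × ℝ => graphFn α χ 3 p ^ 2).integrable_of_hasCompactSupport
        (hasCompactSupport_of_eq_zero (hasCompactSupport_graphFn (α := α) hs 3) fun p hp => by simp [hp])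
    refine setIntegral_mono_on i1.integrableOn i2.integrableOn measurableSet_strip fun p _ => ?_
    show (Real.sin p.2 * χ p.1 p.2) ^ 2 ≤ χ p.1 p.2 ^ 2
    rw [mul_pow]
    nlinarith [Real.sin_sq_le_one p.2, sq_nonneg (χ p.1 p.2), sq_nonneg (Real.sin p.2)]
  have g3' : 0 ≤ ∫ p in strip, graphFn α χ 3 p ^ 2 := setIntegral_nonneg measurableSet_strip fun p _ => sq_nonneg _
  have hP := integral_strip_sq_le_sq_dθ_of_kMoment h2 hs hχ0 hΨ (fun R hR => by rw [hΨ]; exact hK R hR)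
  have nZ : 0 ≤ ∫ p in strip, (p.1 * dz Ψ p.1 p.2) ^ 2 := setIntegral_nonneg measurableSet_strip fun p _ => sq_nonneg _
  have nE : 0 ≤ ∫ p in strip, Ψ p.1 p.2 ^ 2 := setIntegral_nonneg measurableSet_strip fun p _ => sq_nonneg _
  have nY : 0 ≤ ∫ p in strip, dθ Ψ p.1 p.2 ^ 2 := setIntegral_nonneg measurableSet_strip fun p _ => sq_nonneg _
  rw [g0, g1, g2]
  have hm1 : min (1 / 2) (2 * α) ≤ 1 / 2 := min_le_left _ _
  have hm2 : min (1 / 2) (2 * α) ≤ 2 * α := min_le_right _ _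
  have hm0 : 0 < min (1 / 2) (2 * α) := lt_min (by norm_num) (by linarith)
  set m := min (1 / 2) (2 * α)
  -- `m(E + α²Z + Y + G3) ≤ α²Z + ((5α+α²)/2 − α²)E + Y − 6E + X/2`
  have h5 : 2 * α ≤ α * (5 + α) / 2 - α ^ 2 := by nlinarith
  have f1 := mul_le_mul_of_nonneg_right hm1 nY
  have f2 := mul_le_mul_of_nonneg_right hm1 g3'
  have f3 := mul_le_mul_of_nonneg_right hm2 nE
  have f3' := mul_le_mul_of_nonneg_right h5 nE
  have nZ' : 0 ≤ α ^ 2 * ∫ p in strip, (p.1 * dz Ψ p.1 p.2) ^ 2 := mul_nonneg (sq_nonneg α) nZ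
  have f4 : m * (α ^ 2 * ∫ p in strip, (p.1 * dz Ψ p.1 p.2) ^ 2) ≤ 1 * (α ^ 2 * ∫ p in strip, (p.1 * dz Ψ p.1 p.2) ^ 2) :=
    mul_le_mul_of_nonneg_right (hm1.trans (by norm_num)) nZ'
  generalize (∫ p in strip, Ψ p.1 p.2 ^ 2) = E at *
  generalize (∫ p in strip, (p.1 * dz Ψ p.1 p.2) ^ 2) = Z at *
  generalize (∫ p in strip, dθ Ψ p.1 p.2 ^ 2) = Y at *
  generalize (∫ p in strip, χ p.1 p.2 ^ 2) = X at *
  generalize (∫ p in strip, graphFn α χ 3 p ^ 2) = G at *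
  linarith [f1, f2, f3, f3', f4, g3, hP]

set_option maxHeartbeats 4000000 in
/-- **Coercivity on the energy space** (by density and continuity). [folklore] -/
theorem energyForm_coercive_weakSpace {α : ℝ} (hα : 0 < α) (hα1 : α ≤ 1) {U : E4} (hU : U ∈ weakSpace α) :
    min (1 / 2) (2 * α) * ‖U‖ ^ 2 ≤ energyForm α U U := by
  have hcl : IsClosed {U : E4 | min (1 / 2) (2 * α) * ‖U‖ ^ 2 ≤ energyForm α U U} := by
    have h1 : Continuous fun p : E4 × E4 => energyForm α p.1 p.2 := (energyForm α).continuous₂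
    have h2 : Continuous fun U : E4 => energyForm α U U := h1.comp (continuous_id.prodMk continuous_id)
    have h3 : Continuous fun U : E4 => min (1 / 2) (2 * α) * ‖U‖ ^ 2 := by fun_prop
    exact isClosed_le h3 h2
  have hsub : (LinearMap.range (graphL α) : Set E4) ⊆ {U : E4 | min (1 / 2) (2 * α) * ‖U‖ ^ 2 ≤ energyForm α U U} := by
    rintro U ⟨χ, rfl⟩
    rw [Set.mem_setOf_eq, graphL_apply]
    exact energyForm_graphElt_self_ge hα hα1 χ.2
  have h := (closure_minimal hsub hcl)
  have hU' : U ∈ closure ((LinearMap.range (graphL α) : Set E4)) := by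
    rw [← Submodule.topologicalClosure_coe]; exact hU
  exact h hU'

/-! ### Weak solutions by Lax–Milgram -/

/-- The energy form restricted to the energy space. [folklore] -/
def energyFormV (α : ℝ) : weakSpace α →L[ℝ] weakSpace α →L[ℝ] ℝ :=
  (((energyForm α).comp (weakSpace α).subtypeL).flip.comp (weakSpace α).subtypeL).flip

/-- Unfolding the restricted form. [folklore] -/
theorem energyFormV_apply (α : ℝ) (u v : weakSpace α) : energyFormV α u v = energyForm α (u : E4) (v : E4) := rfl

/-- **The restricted energy form is coercive** for `0 < α ≤ 1`. [folklore] -/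
theorem isCoercive_energyFormV {α : ℝ} (hα : 0 < α) (hα1 : α ≤ 1) : IsCoercive (energyFormV α) := by
  refine ⟨min (1 / 2) (2 * α), lt_min (by norm_num) (by linarith), fun u => ?_⟩
  rw [energyFormV_apply, mul_assoc, ← sq]
  exact energyForm_coercive_weakSpace hα hα1 u.2

/-- The datum `F ∈ L²(strip)` placed in the first slot of `E⁴`. [folklore] -/
def datumElt (F : L2Strip) : E4 := WithLp.toLp 2 (Pi.single (0 : Fin 4) F)

/-- `⟨ιF, Φ⟩_{E⁴} = ⟨F, Φ₀⟩_{L²}`. [folklore] -/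
theorem inner_datumElt (F : L2Strip) (Φ : E4) : ⟪datumElt F, Φ⟫_ℝ = ⟪F, Φ 0⟫_ℝ := by
  rw [PiLp.inner_apply]
  simp [Fin.sum_univ_four, datumElt]

set_option maxHeartbeats 4000000 in
/-- **Weak existence** (Lax–Milgram in the energy space): for `0 < α ≤ 1` and every `F ∈ L²(strip)`
there is `U` in the energy space with `B(U, Φ) = ⟨F, Φ₀⟩_{L²}` for all `Φ` in the energy space, and
`min(½, 2α)‖U‖ ≤ ‖F‖`. This is the existence half of "the unique `L²` solution" of Proposition 7.1,
in the weak sense. [cite: Elgindi2021, §7.1 Proposition 7.1 (p. 19 of arXiv:1904.04795), "existence and uniqueness follows from the standard L^p theory"] -/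
theorem exists_weakSolution {α : ℝ} (hα : 0 < α) (hα1 : α ≤ 1) (F : L2Strip) :
    ∃ U : E4, U ∈ weakSpace α ∧ (∀ Φ ∈ weakSpace α, energyForm α U Φ = ⟪F, Φ 0⟫_ℝ) ∧
      min (1 / 2) (2 * α) * ‖U‖ ≤ ‖F‖ := by
  have hco := isCoercive_energyFormV hα hα1
  set A := hco.continuousLinearEquivOfBilin with hA
  set g : weakSpace α := (weakSpace α).orthogonalProjectionOnto (datumElt F) with hg
  set u : weakSpace α := A.symm g with hu
  have hweak : ∀ Φ : weakSpace α, energyForm α (u : E4) (Φ : E4) = ⟪F, (Φ : E4) 0⟫_ℝ := by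
    intro Φ
    rw [← energyFormV_apply, ← hco.continuousLinearEquivOfBilin_apply]
    rw [← hA, hu, ContinuousLinearEquiv.apply_symm_apply, hg, Submodule.coe_inner,
      ← Submodule.coe_inner, Submodule.inner_orthogonalProjectionOnto_eq_of_mem_right, inner_datumElt]
  refine ⟨u, u.2, fun Φ hΦ => hweak ⟨Φ, hΦ⟩, ?_⟩
  -- the bound: `c‖u‖² ≤ B(u,u) = ⟨F, u₀⟩ ≤ ‖F‖‖u‖`
  have h1 := energyForm_coercive_weakSpace hα hα1 u.2
  rw [hweak u] at h1
  have h2 : ⟪F, (u : E4) 0⟫_ℝ ≤ ‖F‖ * ‖(u : E4)‖ :=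
    (real_inner_le_norm _ _).trans (mul_le_mul_of_nonneg_left (PiLp.norm_apply_le (u : E4) 0) (norm_nonneg _))
  have hc : 0 < min (1 / 2) (2 * α) := lt_min (by norm_num) (by linarith)
  by_cases hn : ‖(u : E4)‖ = 0
  · rw [hn, mul_zero]; exact norm_nonneg _
  · have hpos : 0 < ‖(u : E4)‖ := lt_of_le_of_ne (norm_nonneg _) (Ne.symm hn)
    have h3 : min (1 / 2) (2 * α) * ‖(u : E4)‖ ^ 2 ≤ ‖F‖ * ‖(u : E4)‖ := h1.trans h2
    rw [sq, ← mul_assoc] at h3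
    exact le_of_mul_le_mul_right h3 hpos

/-- **Weak uniqueness**: two weak solutions in the energy space with the same datum coincide. [cite: Elgindi2021, §7.1 Proposition 7.1 "the unique L² solution" (p. 19 of arXiv:1904.04795)] -/
theorem weakSolution_unique {α : ℝ} (hα : 0 < α) (hα1 : α ≤ 1) {U₁ U₂ : E4} (h1 : U₁ ∈ weakSpace α) (h2 : U₂ ∈ weakSpace α)
    (hw : ∀ Φ ∈ weakSpace α, energyForm α U₁ Φ = energyForm α U₂ Φ) : U₁ = U₂ := by
  have hd : U₁ - U₂ ∈ weakSpace α := Submodule.sub_mem _ h1 h2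
  have hc := energyForm_coercive_weakSpace hα hα1 hd
  have h0 : energyForm α (U₁ - U₂) (U₁ - U₂) = 0 := by
    have e : energyForm α (U₁ - U₂) = energyForm α U₁ - energyForm α U₂ := map_sub _ _ _
    rw [e]
    show energyForm α U₁ (U₁ - U₂) - energyForm α U₂ (U₁ - U₂) = 0
    rw [hw _ hd, sub_self]
  rw [h0] at hc
  have hm : 0 < min (1 / 2) (2 * α) := lt_min (by norm_num) (by linarith)
  have : ‖U₁ - U₂‖ ^ 2 ≤ 0 := by nlinarith
  have : ‖U₁ - U₂‖ = 0 := by nlinarith [norm_nonneg (U₁ - U₂)]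
  exact sub_eq_zero.mp (norm_eq_zero.mp this)

end Elgindi

end Literature.Analysis.FluidPDE
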